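import Summits.Ventures.LatticeQCDFlow.Scaling.TaggedStartContentAboveGlobal
import Summits.Ventures.LatticeQCDFlow.Scaling.TaggedPerAttemptCertificateAbove

/-!
HONEST FRAMING: exact (Metropolis-corrected) sampling algorithms for lattice gauge theory; figures
of merit are autocorrelation/cost numbers at stated couplings and volumes; no continuum-physics
claim.

# TaggedPerAttemptCertificateAboveGlobal — CONJECTURE W′ ON EVERY ADJACENT EDGE FROM A HUB AT OR ABOVE THE MORE PERSISTENT EXTRA PARTICLE (`W_a ≤ W_z`, THE TIE INCLUDED; PRESENT
# CONTENTS BETWEEN THE EXTRA PARTICLES ALLOWED), EVERY `K ≥ 2`: `L·(x̃(★) + (x̃(a) − ỹ(a)) − D_J) ≥ cost(x̃) + cost(ỹ)` FOR EVERY TRUNCATION `J` (lean-2 GEN-42, ours)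

Venture-side (OURS).  Cell `lqcd-flow` (pub-lqcd), unit `pub-lqcd-lean-2-g42`, 2026-08-30.  Chapter AB (route (β), the cost side continued), file 10 = GEN-41 file 10 made global:
its depth-adjacency proviso, the strict `W_a < W_z` and «every other content strictly below `W_b`» are replaced by file 9's dichotomy.  If `N_C(z) ≥ 2` or a present `w ≠ z` has
`W_a ≤ W_w`, there is no deficit at all and W14's ★-certificate (`s1 ≥ 0`) suffices; otherwise `z` is alone at or above `W_a`, every other present content lies strictly below `W_a`,
the hub holds with probability `≤ N_C(z)/K` (GEN-41 file 10 `costSide_hold_above`), `acc(z,a) = 1`, and file 9 (iv)'s budget is GEN-41 file 10's with `t = 1`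
(`costSide_scalar_above`).

* **`tagged_costSide_above_global`** (`L·D_J ≤ 2s1` for the hub alone at or above `W_a`), **`tagged_perAttempt_certificate_above_global`** (Conjecture W′ for every hub with `W_a ≤ W_z`).

With file 6 (hub at most `W_b`, three particles at or above it, every edge), file 7b (the residual pair, depth-adjacent) and this file, what remains of OPEN-MATH (b′) is: the residual
pair on global edges, hubs strictly between `W_b` and `W_a`, and the tie `N_C(z) = 1`, `max_{w≠z} W_w = W_z` (memo MEMO-gen42).  Literature grade (cell rule): OWN; nothing cited;
no new bib keys.
-/

open Finset

namespace Summit.Ventures.LatticeQCDFlow.Scaling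

section AboveGlobal
variable {S : Type*} [Fintype S] [DecidableEq S]
variable {W θ : S → ℝ} {acc : S → S → ℝ} {p σ : ℝ} {K : ℕ} {NC : S → ℕ} {a b : S} {PX PY : Option S → Option S → ℝ}

/-- **THE COST-SIDE INEQUALITY FOR A HUB ALONE AT OR ABOVE `W_a` ON AN ARBITRARY EDGE, EVERY `K ≥ 2`:** `L·D_J ≤ 2·s1` (every other present content strictly below `W_a`; contents
between `W_b` and `W_a` allowed). [ours] -/
theorem tagged_costSide_above_global (hW : ∀ v, 0 < W v) (hp0 : 0 ≤ p) (hp : ∀ v, p * W v ≤ 1) (hθ : ∀ v, θ v = 1 / (1 + p * W v))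
    (hacc : ∀ h v, acc h v = min 1 (W h / W v)) (hK : 2 ≤ K) (hNC : ∑ v, NC v = K) (hab : W b ≤ W a)
    (hPXoff : ∀ h v, h ≠ v → PX (some h) (some v) = if NC h = 0 then 0 else (NC v : ℝ) / K * acc h v)
    (hPXin : ∀ h, PX (some h) none = if NC h = 0 then 0 else acc h a / K)
    (hPXdiag : ∀ h, PX (some h) (some h) = 1 - (∑ v ∈ univ.erase h, PX (some h) (some v) + PX (some h) none))
    (hPXout : ∀ v, PX none (some v) = (NC v : ℝ) / K * acc a v) (hPXstay : PX none none = 1 - ∑ v, PX none (some v))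
    (hPYoff : ∀ h v, h ≠ v → PY (some h) (some v) = if NC h = 0 then 0 else (NC v : ℝ) / K * acc h v)
    (hPYin : ∀ h, PY (some h) none = if NC h = 0 then 0 else acc h b / K)
    (hPYdiag : ∀ h, PY (some h) (some h) = 1 - (∑ v ∈ univ.erase h, PY (some h) (some v) + PY (some h) none))
    (hPYout : ∀ v, PY none (some v) = (NC v : ℝ) / K * acc b v) (hPYstay : PY none none = 1 - ∑ v, PY none (some v))
    {z : S} (hNz : NC z = 1) (haz : W a ≤ W z) (hbelow : ∀ w, w ≠ z → NC w ≠ 0 → W w < W a)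
    {x y : ℕ → Option S → ℝ}
    (hx0 : ∀ v, x 0 v = if v = some z then 1 else 0) (hxs : ∀ n v, x (n + 1) v = ∑ h, x n h * PX h v)
    (hy0 : ∀ v, y 0 v = if v = some z then 1 else 0) (hys : ∀ n v, y (n + 1) v = ∑ h, y n h * PY h v)
    {M : ℝ} (hM : M = ∑ v, θ v * (NC v : ℝ) + θ a) {L : ℝ} (hL : L = 2 * K + M + (∑ v, θ v * (NC v : ℝ) + θ b))
    (hσ0 : 0 ≤ σ) (hσ1 : σ < 1) {ut : Option S → ℝ} (hut : ∀ t, ut t = (1 - σ) * PX (some z) t + σ * ∑ t', ut t' * PX t' t) (J : ℕ) :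
    L * ∑ n ∈ range J, (1 - σ) * σ ^ n * max 0 (y (n + 1) (some z) - x (n + 1) (some z))
      ≤ 2 * ((K + M) * ut none - (∑ v, ut (some v) * (1 - θ v) + ut none * (1 - θ a))) := by
  have hK1 : 1 ≤ K := by omega
  have hK0 : (0 : ℝ) < K := by exact_mod_cast (show 0 < K by omega)
  have hK2r : (2 : ℝ) ≤ K := by exact_mod_cast hK
  have hz : NC z ≠ 0 := by rw [hNz]; exact one_ne_zero
  have hθm := theta_mem hW hp0 hp hθ
  -- the deficit budget (file 9: hub at or above `W_a`, any contents between)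
  obtain ⟨-, -, -, hD2⟩ := tagged_startClass_above_global hW hacc hK hNC hab hPXoff hPXin hPXdiag hPXout hPXstay hPYoff hPYin hPYdiag hPYout hPYstay hz haz hx0 hxs hy0 hys
  have hDJ := hD2 σ hσ0 hσ1 J
  -- the slack income (file 4's identity, as in file 7: no presence proviso)
  obtain ⟨r, hr⟩ : ∃ r : Option S → ℝ, ∀ t, r t = Option.elim t ((K + M) - (1 - θ a)) (fun v => -(1 - θ v)) := ⟨_, fun _ => rfl⟩
  obtain ⟨Λ, hΛ⟩ : ∃ Λ : Option S → ℝ, ∀ t, Λ t = Option.elim t (-(1 - θ a)) (fun _ => 0) := ⟨_, fun _ => rfl⟩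
  obtain ⟨sl, hsl⟩ : ∃ sl : Option S → ℝ, ∀ t, sl t = ∑ t', PX t t' * (r t' + Λ t') - Λ t := ⟨_, fun _ => rfl⟩
  have hrn : r none = (K + M) - (1 - θ a) := by rw [hr]; rfl
  have hrs : ∀ v, r (some v) = -(1 - θ v) := fun v => by rw [hr]; rfl
  have hΛn : Λ none = -(1 - θ a) := by rw [hΛ]; rfl
  have hΛs : ∀ v, Λ (some v) = 0 := fun v => by rw [hΛ]; rfl
  have heq := ledger_tail_eq hsl hut
  have hP0 := tagged_nonneg hW hacc hPXoff hPXin hPXdiag hPXout hPXstay hK1 hNC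
  have hP1 := tagged_rowsum (P := PX) hPXdiag hPXstay
  have hut0 : ∀ t, 0 ≤ ut t := geomResolvent_nonneg hP0 hP1 hσ0 hσ1 (ν := fun t => PX (some z) t) (fun t => hP0 _ _) hut
  have hsl_none : 0 ≤ sl none := by
    rw [hsl]; linarith [tagged_supersolution_none hW hp0 hp hθ hacc hPXout hPXstay hK1 hNC hM hrn hrs hΛn hΛs]
  have hsl_some : ∀ v, NC v ≠ 0 → 0 ≤ sl (some v) := fun v hv => by
    rw [hsl]; linarith [tagged_supersolution_some hW hp0 hp hθ hacc hPXoff hPXin hPXdiag hK1 hNC hM hrn hrs hΛn hΛs hv]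
  have hE : 0 ≤ ∑ t, ut t * sl t := by
    rw [tagged_sum_option]
    refine add_nonneg (mul_nonneg (hut0 none) hsl_none) (sum_nonneg fun v _ => ?_)
    by_cases hv : NC v = 0
    · rw [tagged_tail_absent hW hacc hPXoff hPXin hPXdiag hPXout hPXstay hK1 hNC hσ0 hσ1 hz hut hv, zero_mul]
    · exact mul_nonneg (hut0 _) (hsl_some v hv)
  have hΛz : Λ (some z) = 0 := hΛs z
  have hEΛ : ∑ t, ut t * Λ t = -(1 - θ a) * ut none := by rw [tagged_sum_option, hΛn]; simp [hΛs]; ring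
  have hEr : ∑ t, ut t * r t = (K + M) * ut none - (∑ v, ut (some v) * (1 - θ v) + ut none * (1 - θ a)) := by
    rw [tagged_sum_option, hrn]; simp only [hrs]
    have e : ∑ v, ut (some v) * -(1 - θ v) = -∑ v, ut (some v) * (1 - θ v) := by rw [← sum_neg_distrib]; exact sum_congr rfl fun v _ => by ring
    rw [e]; ring
  have hs1' : (1 - σ) * sl (some z) ≤ (K + M) * ut none - (∑ v, ut (some v) * (1 - θ v) + ut none * (1 - θ a)) := by
    rw [← hEr, heq, hΛz, hEΛ]
    have h1 : 0 ≤ σ * ∑ t, ut t * sl t := mul_nonneg hσ0 hE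
    have h2 : 0 ≤ (1 - σ) * (0 - -(1 - θ a) * ut none) := by
      have e : (1 - σ) * (0 - -(1 - θ a) * ut none) = (1 - σ) * ((1 - θ a) * ut none) := by ring
      rw [e]
      exact mul_nonneg (by linarith only [hσ1]) (mul_nonneg (by linarith only [(hθm a).2]) (hut0 none))
    linarith only [h1, h2]
  -- the hub slack: `P_X(z,z) ≤ N_C(z)/K` and `acc(z,a) = 1`
  have hhold : PX (some z) (some z) ≤ (NC z : ℝ) / K :=
    costSide_hold_above hW hacc hK1 hNC hPXoff hPXin hPXdiag hz haz (fun w hw hNw => (hbelow w hw hNw).le.trans haz)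
  have hslack := costSide_slack_ge hW hp0 hp hθ hacc hPXoff hPXin hK1 hM hrn hrs hΛn hΛs hsl hz hhold
  have hacc_za : acc z a = 1 := by rw [hacc]; exact min_eq_left ((one_le_div (hW a)).mpr haz)
  rw [hacc_za, one_mul] at hslack
  -- `L ≤ 4K + 2`, the scalar inequality
  have hMC : ∑ v, θ v * (NC v : ℝ) ≤ K := by
    calc ∑ v, θ v * (NC v : ℝ) ≤ ∑ v, (NC v : ℝ) := sum_le_sum fun v _ => mul_le_of_le_one_left (Nat.cast_nonneg _) (hθm v).2
      _ = K := by exact_mod_cast hNC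
  have hMC0 : 0 ≤ ∑ v, θ v * (NC v : ℝ) := sum_nonneg fun v _ => mul_nonneg (by linarith [(hθm v).1]) (Nat.cast_nonneg _)
  have hL0 : 0 ≤ L := by rw [hL, hM]; linarith only [hMC0, (hθm a).1, (hθm b).1, hK0]
  have hL4 : L ≤ 4 * K + 2 := by rw [hL, hM]; linarith only [hMC, (hθm a).2, (hθm b).2]
  have hscal := costSide_scalar_above hK2r hL4 zero_le_one le_rfl (hθm a).1 hσ0 hσ1.le (t := 1)
  calc L * ∑ n ∈ range J, (1 - σ) * σ ^ n * max 0 (y (n + 1) (some z) - x (n + 1) (some z))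
      ≤ L * ((1 - σ) * ((1 : ℝ) / (1 + 1) * (1 / (K : ℝ)) * ((σ * (1 / (K : ℝ))) ^ 2 / (1 - (σ * (1 / (K : ℝ))) ^ 2)))) :=
        mul_le_mul_of_nonneg_left hDJ hL0
    _ = (1 - σ) * (L * ((1 : ℝ) / (1 + 1) * (1 / (K : ℝ)) * ((σ * (1 / (K : ℝ))) ^ 2 / (1 - (σ * (1 / (K : ℝ))) ^ 2)))) := by ring
    _ ≤ (1 - σ) * (2 * (((K : ℝ) - 2 + 3 * θ a) / K)) := mul_le_mul_of_nonneg_left hscal (by linarith)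
    _ ≤ (1 - σ) * (2 * sl (some z)) := mul_le_mul_of_nonneg_left (by linarith only [hslack]) (by linarith only [hσ1])
    _ = 2 * ((1 - σ) * sl (some z)) := by ring
    _ ≤ 2 * ((K + M) * ut none - (∑ v, ut (some v) * (1 - θ v) + ut none * (1 - θ a))) := mul_le_mul_of_nonneg_left hs1' (by norm_num)

/-- **CONJECTURE W′ ON A DEPTH-ADJACENT EDGE, FOURTH CONFIGURATION, EVERY `K ≥ 2`:** `cost(x̃) + cost(ỹ) ≤ L·(x̃(★) + (x̃(a)−ỹ(a)) − D_J)`. [ours] -/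
theorem tagged_perAttempt_certificate_above_global (hW : ∀ v, 0 < W v) (hp0 : 0 ≤ p) (hp : ∀ v, p * W v ≤ 1) (hθ : ∀ v, θ v = 1 / (1 + p * W v))
    (hacc : ∀ h v, acc h v = min 1 (W h / W v)) (hK : 2 ≤ K) (hNC : ∑ v, NC v = K) (hab : W b ≤ W a)
    (hPXoff : ∀ h v, h ≠ v → PX (some h) (some v) = if NC h = 0 then 0 else (NC v : ℝ) / K * acc h v)
    (hPXin : ∀ h, PX (some h) none = if NC h = 0 then 0 else acc h a / K)
    (hPXdiag : ∀ h, PX (some h) (some h) = 1 - (∑ v ∈ univ.erase h, PX (some h) (some v) + PX (some h) none))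
    (hPXout : ∀ v, PX none (some v) = (NC v : ℝ) / K * acc a v) (hPXstay : PX none none = 1 - ∑ v, PX none (some v))
    (hPYoff : ∀ h v, h ≠ v → PY (some h) (some v) = if NC h = 0 then 0 else (NC v : ℝ) / K * acc h v)
    (hPYin : ∀ h, PY (some h) none = if NC h = 0 then 0 else acc h b / K)
    (hPYdiag : ∀ h, PY (some h) (some h) = 1 - (∑ v ∈ univ.erase h, PY (some h) (some v) + PY (some h) none))
    (hPYout : ∀ v, PY none (some v) = (NC v : ℝ) / K * acc b v) (hPYstay : PY none none = 1 - ∑ v, PY none (some v))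
    {z : S} (hz : NC z ≠ 0) (haz : W a ≤ W z)
    {x y : ℕ → Option S → ℝ}
    (hx0 : ∀ v, x 0 v = if v = some z then 1 else 0) (hxs : ∀ n v, x (n + 1) v = ∑ h, x n h * PX h v)
    (hy0 : ∀ v, y 0 v = if v = some z then 1 else 0) (hys : ∀ n v, y (n + 1) v = ∑ h, y n h * PY h v)
    {M : ℝ} (hM : M = ∑ v, θ v * (NC v : ℝ) + θ a) {L : ℝ} (hL : L = 2 * K + M + (∑ v, θ v * (NC v : ℝ) + θ b))
    (hσ0 : 0 ≤ σ) (hσ1 : σ < 1) {xt yt xs ys : Option S → ℝ}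
    (hxt : ∀ t, xt t = (1 - σ) * PX (some z) t + σ * ∑ t', xt t' * PX t' t) (hyt : ∀ t, yt t = (1 - σ) * PY (some z) t + σ * ∑ t', yt t' * PY t' t)
    (hxsr : ∀ t, xs t = (1 - σ) * PX none t + σ * ∑ t', xs t' * PX t' t) (hysr : ∀ t, ys t = (1 - σ) * PY none t + σ * ∑ t', ys t' * PY t' t) (J : ℕ) :
    (∑ v, xt (some v) * (1 - θ v) + xt none * (1 - θ a)) + (∑ v, yt (some v) * (1 - θ v) + yt none * (1 - θ b))
      ≤ L * (xt none + (xt (some a) - yt (some a)) - ∑ n ∈ range J, (1 - σ) * σ ^ n * max 0 (y (n + 1) (some z) - x (n + 1) (some z))) := by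
  have hK1 : 1 ≤ K := by omega
  have hθm := theta_mem hW hp0 hp hθ
  have hMY : (∑ v, θ v * (NC v : ℝ) + θ b) = M + (θ b - θ a) := by rw [hM]; ring
  have hdec := ledger_perStep_eq (θ := θ) (x := xt) (y := yt) (z := z) (a := a)
    (pen := ∑ n ∈ range J, (1 - σ) * σ ^ n * max 0 (y (n + 1) (some z) - x (n + 1) (some z))) hMY hL
  have hDstar := tagged_star_domination hW hacc hK1 hNC hab hPXoff hPXin hPXdiag hPXout hPXstay hPYoff hPYin hPYdiag hPYout hPYstay hσ0 hσ1 hxsr hysr z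
  have hs3 := S2_of_star_domination hW hp0 hp hθ hacc hK1 hNC hab hPXoff hPXin hPXdiag hPXout hPXstay hPYoff hPYin hPYout hσ0 hσ1 hz hxt hyt hxsr hysr hDstar
  have hdom := tagged_hub_domination hW hacc hK1 hNC hab hPXoff hPXin hPXdiag hPXout hPXstay hPYoff hPYin hPYdiag hPYout hPYstay hσ0 hσ1 hz hxt hyt
  have hgap_a : 0 ≤ xt (some a) - yt (some a) := by linarith [hdom a]
  have hgaps : 0 ≤ ∑ v ∈ univ.erase z, (xt (some v) - yt (some v)) * (1 - θ v) :=
    sum_nonneg fun v _ => mul_nonneg (by linarith [hdom v]) (by linarith [(hθm v).2])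
  have hez : 0 ≤ -((1 - θ z) * (yt (some z) - xt (some z))) := by
    have h1 : 0 ≤ 1 - θ z := by linarith [(hθm z).2]
    have h2 : yt (some z) - xt (some z) ≤ 0 := by linarith [hdom z]
    nlinarith
  -- the cost side: no deficit with a third particle at or above `W_a` (file 9 (i)); otherwise the hub is alone up there and file 9 (iv) is paid as in GEN-41 file 10
  have hcost : L * ∑ n ∈ range J, (1 - σ) * σ ^ n * max 0 (y (n + 1) (some z) - x (n + 1) (some z))
      ≤ 2 * ((K + M) * xt none - (∑ v, xt (some v) * (1 - θ v) + xt none * (1 - θ a))) := by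
    by_cases hw : 2 ≤ NC z ∨ ∃ w, w ≠ z ∧ NC w ≠ 0 ∧ W a ≤ W w
    · obtain ⟨hC, -, -, -⟩ := tagged_startClass_above_global hW hacc hK hNC hab hPXoff hPXin hPXdiag hPXout hPXstay hPYoff hPYin hPYdiag hPYout hPYstay hz haz hx0 hxs hy0 hys
      have hD0 : ∑ n ∈ range J, (1 - σ) * σ ^ n * max 0 (y (n + 1) (some z) - x (n + 1) (some z)) = 0 := by
        refine sum_eq_zero fun n _ => ?_
        rw [max_eq_left (by linarith [hC hw (n + 1)]), mul_zero]
      rw [hD0, mul_zero]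
      -- `s1 ≥ 0` (W14∕W15's ★-certificate, tail form, no presence proviso)
      have h := tagged_certificate_tail' hW hp0 hp hθ hacc hPXoff hPXin hPXdiag hPXout hPXstay hK1 hNC hM hσ0 hσ1 hz hxt
      have hP0 := tagged_nonneg hW hacc hPXoff hPXin hPXdiag hPXout hPXstay hK1 hNC
      have hP1 := tagged_rowsum (P := PX) hPXdiag hPXstay
      have hx0' : 0 ≤ xt none := geomResolvent_nonneg hP0 hP1 hσ0 hσ1 (ν := fun t => PX (some z) t) (fun t => hP0 _ _) hxt none
      have h0 : 0 ≤ (1 - σ) * (1 - θ a) * xt none := mul_nonneg (mul_nonneg (by linarith) (by linarith [(hθm a).2])) hx0'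
      linarith
    · have hz2 : ¬ 2 ≤ NC z := fun h => hw (Or.inl h)
      have hNz : NC z = 1 := by omega
      have hbelow : ∀ w, w ≠ z → NC w ≠ 0 → W w < W a := fun w hwz hNw =>
        lt_of_not_ge fun hle => hw (Or.inr ⟨w, hwz, hNw, hle⟩)
      exact tagged_costSide_above_global hW hp0 hp hθ hacc hK hNC hab hPXoff hPXin hPXdiag hPXout hPXstay hPYoff hPYin hPYdiag hPYout hPYstay
        hNz haz hbelow hx0 hxs hy0 hys hM hL hσ0 hσ1 hxt J
  have hMC0 : 0 ≤ ∑ v, θ v * (NC v : ℝ) := sum_nonneg fun v _ => mul_nonneg (by linarith [(hθm v).1]) (Nat.cast_nonneg _)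
  have hL0 : 0 ≤ L := by
    have hK0 : (0 : ℝ) ≤ K := Nat.cast_nonneg _
    rw [hL, hM]; nlinarith [(hθm a).1, (hθm b).1]
  have key : 0 ≤ L * (xt none + (xt (some a) - yt (some a)) - ∑ n ∈ range J, (1 - σ) * σ ^ n * max 0 (y (n + 1) (some z) - x (n + 1) (some z)))
      - (∑ v, xt (some v) * (1 - θ v) + xt none * (1 - θ a)) - (∑ v, yt (some v) * (1 - θ v) + yt none * (1 - θ b)) := by
    rw [hdec]
    have hga : 0 ≤ L * (xt (some a) - yt (some a)) := mul_nonneg hL0 hgap_a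
    nlinarith [hs3, hga, hgaps, hez, hcost]
  linarith

end AboveGlobal

end Summit.Ventures.LatticeQCDFlow.Scaling
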